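import Summits.Schanuel.Schanuel.Theorems.ZilberEacGraphLinearSurface
import HarnessLib

/-!
# The equimodular class, XIX: BINOMIAL fibres `A(x₀) y₀^r + B(x₀) = 0` over polynomial graphs of
# every degree are dense — the first members of `y₀`-degree `≥ 2`

HONEST FRAMING.  Cell `pub-schanuel` (Zilber's Exponential-Algebraic Closedness, case ladder;
host summit Schanuel), seat 2, gen 23.  THEOREM EL (file XVI) decided the `y₀`-linear fibres.  Here
**`unprojectedDense_graphBinomialSurface`**: `p ∈ ℂ[X]` with `deg p ≥ 2`, `r ≥ 1`,
`P(x₀, y₀) = A(x₀) y₀^r + B(x₀)` irreducible with `deg A = deg B ≥ 1`, `A, B` coprime.  Then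
`{x₁ = p(x₀), P(x₀, y₀) = 0}` has Zariski-dense exponential points.  These `r`-fold covers are, for
`r ≥ 2`, members of gen 18's residual EQUIMODULAR class of `y₀`-degree `≥ 2` (all top-row roots
`θ`, `θ^r = -lc B/lc A`, lie on one circle; e.g. `{x₁ = x₀³, x₀ y₀² = x₀ + 1}`).  Proof: the
substitution `x₀ = x₀'/r` turns the exponential points `A(z) e^{rz} + B(z) = 0` into those of the
`y₀`-linear datum `(A(X/r), B(X/r), p(X/r))`, to which files XIII–XV apply verbatim: ALL branches
`y₀ = ω θ^{1/r}(1 + …)` are covered by ONE family of labels `z = (τ' + 2πik)/r + Λ(z)/r`, the exact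
identity reads `e^{x₁} = e^{P̃((τ' + 2πik)/r·r…)}`—precisely `e^{p(z)} = e^{P̃_r(τ' + 2πik)}·w(r/x₀… )`
with `P̃_r` the polar correction of `p(X/r)` — and the growth / resonance / Kronecker trichotomy
decides.  Complete classes of instances of an OPEN question (PLMS 2024 §1 p. 5); general fibre curves
of `y₀`-degree `≥ 2` (several circles of top-row roots, non-binomial) remain; EC(3,2) OPEN; NOT
Schanuel's conjecture (neither used nor implied; EAC ⇏ SC).
-/

noncomputable section

open Filter Topology Set Complex MvPolynomial
open Literature.NumberTheory.Transcendental Literature.ModelTheory.Zilber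
open Literature.ModelTheory.ExponentialFields

set_option linter.dupNamespace false

namespace Summit.Schanuel.Schanuel.Theorems

/-! ## Part A. The substitution `X ↦ c·X` -/

section Scaling

/-- Degree is preserved by `X ↦ c X`, `c ≠ 0`. [folklore] -/
theorem natDegree_comp_C_mul_X' (A : Polynomial ℂ) {c : ℂ} (hc : c ≠ 0) :
    (A.comp (Polynomial.C c * Polynomial.X)).natDegree = A.natDegree := by
  rw [Polynomial.natDegree_comp, Polynomial.natDegree_C_mul_X _ hc, mul_one]

/-- Leading coefficient under `X ↦ c X`. [folklore] -/
theorem leadingCoeff_comp_C_mul_X' (A : Polynomial ℂ) {c : ℂ} (hc : c ≠ 0) :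
    (A.comp (Polynomial.C c * Polynomial.X)).leadingCoeff = A.leadingCoeff * c ^ A.natDegree := by
  rw [Polynomial.leadingCoeff_comp (by rw [Polynomial.natDegree_C_mul_X _ hc]; exact one_ne_zero),
    Polynomial.leadingCoeff_C_mul_X]

/-- Coprimality is preserved by substitution. [folklore] -/
theorem isCoprime_comp {A B : Polynomial ℂ} (h : IsCoprime A B) (q : Polynomial ℂ) :
    IsCoprime (A.comp q) (B.comp q) := by
  obtain ⟨u, v, huv⟩ := h
  refine ⟨u.comp q, v.comp q, ?_⟩
  rw [← Polynomial.mul_comp, ← Polynomial.mul_comp, ← Polynomial.add_comp, huv, Polynomial.one_comp]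

/-- Transcendence at `0` (in the sense of THEOREM T) is preserved by rescaling the argument:
`u ↦ w(c u)`, `c ≠ 0`. [folklore] -/
theorem transcendental_comp_mul {w : ℂ → ℂ} {c : ℂ} (hc : c ≠ 0)
    (htr : ∀ H : Polynomial (Polynomial ℂ), H ≠ 0 →
      ¬ (∀ᶠ u in 𝓝[≠] (0 : ℂ), (H.map (Polynomial.evalRingHom u⁻¹)).eval (w u) = 0))
    (H : Polynomial (Polynomial ℂ)) (hH0 : H ≠ 0) :
    ¬ (∀ᶠ v in 𝓝[≠] (0 : ℂ), (H.map (Polynomial.evalRingHom v⁻¹)).eval (w (c * v)) = 0) := by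
  intro h
  set q : Polynomial ℂ := Polynomial.C c * Polynomial.X with hq
  set Hc : Polynomial (Polynomial ℂ) := H.map (Polynomial.compRingHom q) with hHc
  refine htr Hc ?_ ?_
  · -- `Hc ≠ 0`: substitution by `c X` is injective
    intro h0
    apply hH0
    have hinj : Function.Injective (Polynomial.compRingHom q : Polynomial ℂ → Polynomial ℂ) := by
      intro a b hab
      have hab' : (a - b).comp q = 0 := by
        rw [Polynomial.sub_comp]
        exact sub_eq_zero.2 hab
      rcases Polynomial.comp_eq_zero_iff.1 hab' with h1 | ⟨-, h2⟩
      · exact sub_eq_zero.1 h1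
      · exfalso
        have := congrArg (fun p : Polynomial ℂ => p.coeff 1) h2
        simp [hq, hc] at this
    exact (Polynomial.map_injective _ hinj) (by rw [← hHc, h0, Polynomial.map_zero])
  · -- the relation along `u = c v`
    have hmap : Tendsto (fun u : ℂ => c⁻¹ * u) (𝓝[≠] (0 : ℂ)) (𝓝[≠] (0 : ℂ)) := by
      refine tendsto_nhdsWithin_iff.2 ⟨?_, ?_⟩
      · have : Tendsto (fun u : ℂ => c⁻¹ * u) (𝓝 (0 : ℂ)) (𝓝 (c⁻¹ * 0)) :=
          (continuous_const.mul continuous_id).tendsto 0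
        rw [mul_zero] at this
        exact this.mono_left nhdsWithin_le_nhds
      · exact eventually_nhdsWithin_of_forall fun u hu => mul_ne_zero (inv_ne_zero hc) hu
    filter_upwards [hmap.eventually h] with u hu
    have e1 : c * (c⁻¹ * u) = u := by field_simp
    have e2 : (c⁻¹ * u)⁻¹ = q.eval u⁻¹ := by rw [hq]; simp; ring
    rw [e1, e2] at hu
    rw [hHc, Polynomial.map_map]
    have hcomp : (Polynomial.evalRingHom u⁻¹).comp (Polynomial.compRingHom q) =
        Polynomial.evalRingHom (q.eval u⁻¹) := by
      refine RingHom.ext fun a => ?_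
      simp [Polynomial.eval_comp]
    rw [hcomp]
    exact hu

end Scaling

/-! ## Part B. THEOREM EL for binomial fibres -/

section Main

variable (A B : Polynomial ℂ) {P : MvPolynomial (Fin 2) ℂ}

/-- **BINOMIAL FIBRES OVER POLYNOMIAL GRAPHS ARE DENSE.**  `P(x₀, y₀) = A(x₀) y₀^r + B(x₀)`
irreducible, `r ≥ 1`, `deg A = deg B ≥ 1`, `A, B` coprime, `lc B = -e^{τ'} lc A`; `p ∈ ℂ[X]`,
`deg p ≥ 2`.  Then `{x₁ = p(x₀), P(x₀, y₀) = 0}` has Zariski-dense exponential points.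
[cite: MantovaMasser2023, §1 Further remarks, p. 5 (the question, open in general)] (new) -/
theorem unprojectedDense_graphBinomialSurface {r : ℕ} (hr : 1 ≤ r)
    (hP : ∀ x y : ℂ, MvPolynomial.eval ![x, y] P = A.eval x * y ^ r + B.eval x) (hirr : Irreducible P)
    (hN : 1 ≤ A.natDegree) (hdeg : B.natDegree = A.natDegree) (hcop : IsCoprime A B)
    (p : Polynomial ℂ) (hd : 2 ≤ p.natDegree) (τ' : ℂ)
    (hlc : B.leadingCoeff = -Complex.exp τ' * A.leadingCoeff) :
    UnprojectedDense {w : Fin 2 ⊕ Fin 2 → ℂ | w (Sum.inl 1) = p.eval (w (Sum.inl 0)) ∧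
      MvPolynomial.eval ![w (Sum.inl 0), w (Sum.inr 0)] P = 0} := by
  classical
  -- the rescaled datum `x₀ = x₀'/r`
  set rC : ℂ := (r : ℂ) with hrC
  have hr0 : rC ≠ 0 := by rw [hrC]; exact_mod_cast (by omega : r ≠ 0)
  have hri : rC⁻¹ ≠ 0 := inv_ne_zero hr0
  set qr : Polynomial ℂ := Polynomial.C rC⁻¹ * Polynomial.X with hqr
  have hqr_ev : ∀ x : ℂ, qr.eval x = rC⁻¹ * x := fun x => by simp [hqr]
  set Ar : Polynomial ℂ := A.comp qr with hAr
  set Br : Polynomial ℂ := B.comp qr with hBr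
  set pr : Polynomial ℂ := p.comp qr with hpr
  have hNr : 1 ≤ Ar.natDegree := by rw [hAr, natDegree_comp_C_mul_X' A hri]; exact hN
  have hdegr : Br.natDegree = Ar.natDegree := by
    rw [hAr, hBr, natDegree_comp_C_mul_X' A hri, natDegree_comp_C_mul_X' B hri, hdeg]
  have hcopr : IsCoprime Ar Br := isCoprime_comp hcop qr
  have hdr : 2 ≤ pr.natDegree := by rw [hpr, natDegree_comp_C_mul_X' p hri]; exact hd
  have hlcr : Br.leadingCoeff = -Complex.exp τ' * Ar.leadingCoeff := by
    rw [hAr, hBr, leadingCoeff_comp_C_mul_X' A hri, leadingCoeff_comp_C_mul_X' B hri, hdeg, hlc]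
    ring
  -- the witness and the labelled exponential points for the rescaled datum
  obtain ⟨Pt, w, R, -, -, -, hw, hw0, hK2, htr⟩ := exists_graph_witness Ar Br hNr hdegr hcopr pr hdr τ' hlcr
  obtain ⟨k₀, z', hzlab, hzeq', hzR, hznorm', hzup⟩ := exists_labelled_expPoints Ar Br hNr hdegr τ' hlcr R
  -- back to the original coordinate: `z = z'/r`
  set z : ℕ → ℂ := fun m => rC⁻¹ * z' m with hz
  have hzz : ∀ m, rC * z m = z' m := fun m => by rw [hz]; field_simp
  have hA_ev : ∀ m, Ar.eval (z' m) = A.eval (z m) := fun m => by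
    rw [hAr, Polynomial.eval_comp, hqr_ev]
  have hB_ev : ∀ m, Br.eval (z' m) = B.eval (z m) := fun m => by
    rw [hBr, Polynomial.eval_comp, hqr_ev]
  have hp_ev : ∀ m, pr.eval (z' m) = p.eval (z m) := fun m => by
    rw [hpr, Polynomial.eval_comp, hqr_ev]
  have hexp_r : ∀ m, Complex.exp (z m) ^ r = Complex.exp (z' m) := fun m => by
    rw [← Complex.exp_nat_mul, ← hrC, hzz]
  have hzeq : ∀ m, A.eval (z m) * Complex.exp (z m) ^ r + B.eval (z m) = 0 := fun m => by
    rw [hexp_r, ← hA_ev, ← hB_ev]; exact hzeq' m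
  have hznorm : Tendsto (fun m => ‖z m‖) atTop atTop := by
    have : (fun m => ‖z m‖) = fun m => ‖rC⁻¹‖ * ‖z' m‖ := funext fun m => by rw [hz, norm_mul]
    rw [this]
    exact hznorm'.const_mul_atTop (norm_pos_iff.2 hri)
  -- the phase polynomial and the exact identity
  set PK : Polynomial ℂ := Pt.comp (Polynomial.C τ' + Polynomial.C (2 * Real.pi * I) * Polynomial.X)
    with hPK
  have hPKev : ∀ k : ℕ, PK.eval (((k : ℝ) : ℂ)) = Pt.eval (τ' + (((k : ℕ) : ℤ) : ℂ) * (2 * Real.pi * I)) := by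
    intro k
    rw [hPK, Polynomial.eval_comp]
    simp only [Polynomial.eval_add, Polynomial.eval_mul, Polynomial.eval_C, Polynomial.eval_X]
    push_cast
    ring_nf
  obtain ⟨gR, gI, hgR, hexpPK⟩ := exists_re_im_polynomials PK
  have hid : ∀ m, Complex.exp (p.eval (z m)) =
      urot (gI.eval ((k₀ + m : ℕ) : ℝ)) *
        ((Real.exp (gR.eval ((k₀ + m : ℕ) : ℝ)) : ℂ) * w (z' m)⁻¹) := by
    intro m
    obtain ⟨k', hk'lab, hk'⟩ := hK2 (z' m) (hzR m) (hzeq' m)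
    have hkk : k' = ((k₀ + m : ℕ) : ℤ) :=
      int_eq_of_norm_sub_lt hk'lab (by exact_mod_cast hzlab m)
    rw [← hp_ev, hk', hkk, ← hPKev, hexpPK]
    ring
  have hzinv : ∀ m, (z' m)⁻¹ = rC⁻¹ * (z m)⁻¹ := fun m => by
    rw [← hzz m, mul_inv]
  -- the sequence of exponential points of the surface
  have hirr3 := irreducible_rename_castSucc₂ hirr
  have hS := isIrreducibleClosed_graphSurface p hirr3
  have hdim := zariskiDim_graphSurface p hirr3
  rw [fibreCurveSurface_eq]
  set S := {w : Fin 2 ⊕ Fin 2 → ℂ | w (Sum.inl 1) = p.eval (w (Sum.inl 0)) ∧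
      MvPolynomial.eval ![w (Sum.inl 0), w (Sum.inr 0), w (Sum.inr 1)]
        (rename (Fin.castSucc : Fin 2 → Fin 3) P) = 0} with hSdef
  set q : ℕ → Fin 2 ⊕ Fin 2 → ℂ := fun m =>
    Sum.elim ![z m, p.eval (z m)] ![Complex.exp (z m), Complex.exp (p.eval (z m))] with hq
  have hqS : ∀ m, q m ∈ S := by
    intro m
    refine ⟨by simp [hq], ?_⟩
    have ev : (![q m (Sum.inl 0), q m (Sum.inr 0), q m (Sum.inr 1)] : Fin 3 → ℂ) =
        ![z m, Complex.exp (z m), Complex.exp (p.eval (z m))] := by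
      simp [hq]
    rw [ev, eval_vec3_rename_castSucc, hP]
    exact hzeq m
  have hqΓ : ∀ m, q m ∈ expGraph ℂ 2 := by
    intro m
    rw [mem_expGraph_iff]
    intro i
    rw [Literature.ModelTheory.ExponentialFields.ExponentialRing.complex_exp_eq]
    fin_cases i <;> simp [hq]
  have hwlim : Tendsto (fun m => w (z' m)⁻¹) atTop (𝓝 (w 0)) :=
    hw.continuousAt.tendsto.comp (tendsto_inv₀_cobounded.comp (tendsto_norm_atTop_iff_cobounded.1 hznorm'))
  -- the rescaled witness as a function of `1/x₀`
  set wr : ℂ → ℂ := fun v => w (rC⁻¹ * v) with hwr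
  have hwr_an : AnalyticAt ℂ wr 0 := by
    have h1 : AnalyticAt ℂ (fun v : ℂ => rC⁻¹ * v) 0 := analyticAt_const.mul analyticAt_id
    have h2 : AnalyticAt ℂ w (rC⁻¹ * 0) := by rw [mul_zero]; exact hw
    exact h2.comp h1
  have hwr_ev : ∀ m, w (z' m)⁻¹ = wr (z m)⁻¹ := fun m => by rw [hwr, hzinv]
  have htr_r : ∀ H : Polynomial (Polynomial ℂ), H ≠ 0 →
      ¬ (∀ᶠ v in 𝓝[≠] (0 : ℂ), (H.map (Polynomial.evalRingHom v⁻¹)).eval (wr v) = 0) :=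
    transcendental_comp_mul hri htr
  by_cases hgRdeg : 1 ≤ gR.natDegree
  · /- (a) GROWTH -/
    have hre : ∀ m, (p.eval (z m)).re = gR.eval ((k₀ + m : ℕ) : ℝ) + Real.log ‖w (z' m)⁻¹‖ := by
      intro m
      have h1 := congrArg (fun x : ℂ => Real.log ‖x‖) (hid m)
      simp only [Complex.norm_exp, Real.log_exp, norm_mul, norm_urot, one_mul, Complex.norm_real,
        Real.norm_eq_abs, Real.abs_exp] at h1
      rw [h1, Real.log_mul (Real.exp_pos _).ne' (norm_ne_zero_iff.2 (hw0 _)), Real.log_exp]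
    have hloglim : Tendsto (fun m => Real.log ‖w (z' m)⁻¹‖) atTop (𝓝 (Real.log ‖w 0‖)) :=
      (Real.continuousAt_log (norm_ne_zero_iff.2 (hw0 0))).tendsto.comp hwlim.norm
    obtain ⟨M, hM⟩ : ∃ M : ℝ, ∀ m, |Real.log ‖w (z' m)⁻¹‖| ≤ M := by
      obtain ⟨C, hC⟩ := isBounded_iff_forall_norm_le.1 (Metric.isBounded_range_of_tendsto _ hloglim)
      exact ⟨C, fun m => by simpa [Real.norm_eq_abs] using hC _ ⟨m, rfl⟩⟩
    have ha : ∀ m, |(p.eval (z m)).re - gR.eval ((k₀ + m : ℕ) : ℝ)| ≤ M := by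
      intro m; rw [hre m, add_sub_cancel_left]; exact hM m
    -- the denominator: `‖z m‖ ≤ ‖z' m‖` since `r ≥ 1`
    have hzup' : ∀ m, ‖z m‖ ≤ ‖τ'‖ + 1 + 7 * ((k₀ + m : ℕ) : ℝ) := by
      intro m
      refine le_trans ?_ (hzup m)
      rw [hz, norm_mul, norm_inv, hrC, Complex.norm_natCast]
      have hr1 : (1 : ℝ) ≤ (r : ℝ) := by exact_mod_cast hr
      have := norm_nonneg (z' m)
      calc (r : ℝ)⁻¹ * ‖z' m‖ ≤ 1 * ‖z' m‖ :=
            mul_le_mul_of_nonneg_right (inv_le_one_of_one_le₀ hr1) this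
        _ = ‖z' m‖ := one_mul _
    obtain ⟨D, hD, hLD⟩ := log_two_add_norm_eval_le_log_label p (α := ‖τ'‖ + 1) (by positivity)
    have hgr : Tendsto (fun m => |(p.eval (z m)).re| / Real.log (2 + ‖p.eval (z m)‖)) atTop atTop :=
      tendsto_abs_div_log_of_linear_growth hgRdeg k₀ hD ha
        (fun m => Real.log_le_log two_pos (by linarith [norm_nonneg (p.eval (z m))]))
        (fun m => hLD (z m) _ (Nat.cast_nonneg _) (hzup' m))
    refine unprojectedDense_of_growth hS (le_of_eq hdim) 1 hqS hqΓ ?_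
    refine hgr.congr fun m => ?_
    simp [hq]
  · /- `g_R` constant -/
    have hgR0 : gR.natDegree = 0 := by omega
    set r₀ : ℝ := gR.coeff 0 with hr₀
    have hgRev : ∀ x : ℝ, gR.eval x = r₀ := fun x => by
      rw [Polynomial.eq_C_of_natDegree_eq_zero hgR0, Polynomial.eval_C]
    set c₀ : ℂ := ((Real.exp r₀ : ℝ) : ℂ) with hc₀
    have hc₀0 : c₀ ≠ 0 := by rw [hc₀]; exact_mod_cast (Real.exp_pos r₀).ne'
    have hid' : ∀ m, Complex.exp (p.eval (z m)) =
        urot (gI.eval ((k₀ + m : ℕ) : ℝ)) * (c₀ * wr (z m)⁻¹) := by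
      intro m; rw [hid m, hgRev, hwr_ev]
    rcases urot_eval_periodic_or_not_near_finset gI with ⟨Dp, hDp, hper⟩ | hfar
    · /- (b) RESONANCE -/
      set phase : ℕ → ℂ := fun k => urot (gI.eval (k : ℝ)) with hphase
      have hperiodic : Function.Periodic phase Dp := fun k => hper k
      set g : ℕ → Fin Dp := fun m => ⟨(k₀ + m) % Dp, Nat.mod_lt _ hDp⟩ with hg
      obtain ⟨i₀, hi₀⟩ := Finite.exists_infinite_fiber g
      have hSinf : Set.Infinite (g ⁻¹' {i₀}) := Set.infinite_coe_iff.1 hi₀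
      set ζ : ℂ := phase (i₀ : ℕ) * c₀ with hζ
      have hζ0 : ζ ≠ 0 := mul_ne_zero (by rw [hphase]; exact (norm_pos_iff.1 (by rw [norm_urot]; norm_num)))
        hc₀0
      have hphase_eq : ∀ m, g m = i₀ → phase (k₀ + m) = phase (i₀ : ℕ) := by
        intro m hm
        have h1 : ((i₀ : ℕ)) = (k₀ + m) % Dp := by rw [← hm]
        rw [h1]
        exact (hperiodic.map_mod_nat (k₀ + m)).symm
      set φ : ℕ → ℕ := Nat.nth (· ∈ g ⁻¹' {i₀}) with hφ
      have hφS : ∀ j, g (φ j) = i₀ := fun j => Nat.nth_mem_of_infinite (p := (· ∈ g ⁻¹' {i₀})) hSinf j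
      have hφtop : Tendsto φ atTop atTop :=
        (Nat.nth_strictMono (p := (· ∈ g ⁻¹' {i₀})) hSinf).tendsto_atTop
      have hqnorm : Tendsto (fun j => ‖q (φ j) (Sum.inl 0)‖) atTop atTop := by
        refine (hznorm.comp hφtop).congr fun j => ?_
        simp [hq]
      have hw' : AnalyticAt ℂ (fun u => ζ * wr u) 0 := analyticAt_const.mul hwr_an
      have hrel : ∀ j, q (φ j) (Sum.inr 1) = (fun u => ζ * wr u) (q (φ j) (Sum.inl 0))⁻¹ := by
        intro j
        simp only [hq, Sum.elim_inr, Sum.elim_inl, Matrix.cons_val_one, Matrix.cons_val_zero]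
        rw [hid' (φ j), hζ]
        have := hphase_eq (φ j) (hφS j)
        simp only [hphase, Nat.cast_add] at this
        push_cast
        rw [this]
        ring
      exact unprojectedDense_of_transcendental_relation hS (le_of_eq hdim) 0 1 (fun j => hqS (φ j))
        (fun j => hqΓ (φ j)) hqnorm hw' hrel (transcendental_const_mul hζ0 htr_r)
    · /- (c) NON-RESONANCE -/
      by_contra hnot
      have hex : ∃ f, f ∈ vanishingIdeal ℂ (S ∩ expGraph ℂ 2) ∧ f ∉ vanishingIdeal ℂ S := by
        by_contra h
        push Not at h
        exact hnot (le_antisymm h (vanishingIdeal_anti_mono Set.inter_subset_left))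
      obtain ⟨f, hfΓ, hfS⟩ := hex
      obtain ⟨H, hH0, hH⟩ := exists_polyPoly_relation_of_forall_aeval_eq_zero hS (le_of_eq hdim) hqS hfS
        (fun m => (mem_vanishingIdeal_iff.1 hfΓ) _ ⟨hqS m, hqΓ m⟩) (Sum.inl 0) (Sum.inr 1)
      set e : ℕ → ℂ := fun m => urot (gI.eval ((k₀ + m : ℕ) : ℝ)) with he
      have he1 : ∀ m, ‖e m‖ = 1 := fun m => norm_urot _
      have hrel : ∀ m, (H.map (Polynomial.evalRingHom (z m))).eval (e m * (c₀ * wr (z m)⁻¹)) = 0 := by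
        intro m
        have h1 := hH m
        simp only [hq, Sum.elim_inl, Sum.elim_inr, Matrix.cons_val_zero, Matrix.cons_val_one] at h1
        rwa [hid' m] at h1
      have hwlim' : Tendsto (fun m => c₀ * wr (z m)⁻¹) atTop (𝓝 (c₀ * w 0)) := by
        have : (fun m => c₀ * wr (z m)⁻¹) = fun m => c₀ * w (z' m)⁻¹ := funext fun m => by rw [hwr_ev]
        rw [this]
        exact hwlim.const_mul c₀
      obtain ⟨F, hF⟩ := phases_near_finset_of_relation hH0 hznorm he1 (mul_ne_zero hc₀0 (hw0 0)) hwlim' hrel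
      obtain ⟨ε, hε, hfar'⟩ := hfar F
      obtain ⟨m₀, hm₀⟩ := Filter.eventually_atTop.1 (hF ε hε)
      obtain ⟨k, hk, hkfar⟩ := hfar' (k₀ + m₀)
      obtain ⟨ζ, hζF, hζ⟩ := hm₀ (k - k₀) (by omega)
      have hkk : k₀ + (k - k₀) = k := by omega
      rw [he] at hζ
      simp only [hkk] at hζ
      exact absurd hζ (not_lt.2 (hkfar ζ hζF))

/-- **Case ∧ dense for binomial fibres over polynomial graphs.**
[cite: MantovaMasser2023, §1 Further remarks, p. 5 (the question, open in general)] (new) -/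
theorem unprojectedDensityQuestion_graphBinomialSurface {r : ℕ} (hr : 1 ≤ r)
    (hP : ∀ x y : ℂ, MvPolynomial.eval ![x, y] P = A.eval x * y ^ r + B.eval x) (hirr : Irreducible P)
    (hN : 1 ≤ A.natDegree) (hdeg : B.natDegree = A.natDegree) (hcop : IsCoprime A B)
    (p : Polynomial ℂ) (hd : 2 ≤ p.natDegree) (τ' : ℂ)
    (hlc : B.leadingCoeff = -Complex.exp τ' * A.leadingCoeff) :
    MMCaseDimPiOneFree {w : Fin 2 ⊕ Fin 2 → ℂ | w (Sum.inl 1) = p.eval (w (Sum.inl 0)) ∧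
      MvPolynomial.eval ![w (Sum.inl 0), w (Sum.inr 0)] P = 0} ∧
    UnprojectedDense {w : Fin 2 ⊕ Fin 2 → ℂ | w (Sum.inl 1) = p.eval (w (Sum.inl 0)) ∧
      MvPolynomial.eval ![w (Sum.inl 0), w (Sum.inr 0)] P = 0} := by
  refine ⟨mmCase_fibreCurveSurface _ hd hirr ?_,
    unprojectedDense_graphBinomialSurface A B hr hP hirr hN hdeg hcop p hd τ' hlc⟩
  have hA0 : A ≠ 0 := by
    intro h; rw [h, Polynomial.natDegree_zero] at hN; omega
  have hB0 : B ≠ 0 := by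
    intro h
    rw [h, Polynomial.leadingCoeff_zero] at hlc
    exact mul_ne_zero (neg_ne_zero.2 (Complex.exp_ne_zero _)) (Polynomial.leadingCoeff_ne_zero.2 hA0)
      hlc.symm
  refine ((Polynomial.finite_setOf_isRoot (mul_ne_zero hA0 hB0)).infinite_compl).mono ?_
  intro t ht
  simp only [Set.mem_compl_iff, Set.mem_setOf_eq, Polynomial.IsRoot, Polynomial.eval_mul,
    mul_eq_zero, not_or] at ht
  have hA : A.eval t ≠ 0 := ht.1
  obtain ⟨y, hy⟩ := IsAlgClosed.exists_pow_nat_eq (-B.eval t / A.eval t) (by omega : 0 < r)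
  refine ⟨y, ?_, ?_⟩
  · intro hy0
    rw [hy0, zero_pow (by omega)] at hy
    exact div_ne_zero (neg_ne_zero.2 ht.2) hA hy.symm
  · rw [hP, hy, mul_div_cancel₀ _ hA, neg_add_cancel]

end Main

end Summit.Schanuel.Schanuel.Theorems
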